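import Mathlib
import Literature.NumberTheory.Irrationality.Brown2016.DinnerParties
import Literature.NumberTheory.Irrationality.Brown2016.OddConfigurations
import Summits.KontsevichZagierPeriods.Zeta5Search.Cells.ConfigurationsTen
import Summits.KontsevichZagierPeriods.Zeta5Search.Families.FastConvergence
import HarnessLib

/-!
# ζ(5) search — Families: all 771 listed `N = 10` configurations are convergent (kernel-certified)

HONEST FRAMING: systematic search; no irrationality claim unless certified.

Cell `pub-zeta5`, seat P2, for `fam-brown9`.  `Cells/ConfigurationsTen.lean` (fam-brown9) certifies that the 771 plans `reps10` are
seatings, pairwise inequivalent, and identifies the self-dual / named ones, but records that "convergence of all 771 at `N = 10`"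
was NOT kernel-checked (Brown's window test costs ≈ 10⁵ kernel steps per plan).  With the sound fast test of
`Families/FastConvergence.lean` (`fastConv`: every window has two right ends; `isConvergent_of_fastConv`) the kernel does it in 31
blocks of 25 plans: `isConvergent_reps10 : ∀ σ ∈ reps10, IsConvergent 10 σ`.  Hence `𝒞₁₀ ≥ 771` with convergence included
(`card_configurations_ten_ge`); completeness (`𝒞₁₀ ≤ 771`, [Brown2016, App. 2 §10.1]) is not attempted here.
-/

namespace Summit.KontsevichZagierPeriods.Zeta5Search.Families.Configurations

open Literature.NumberTheory.Irrationality.Brown2016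
open Summit.KontsevichZagierPeriods.Zeta5Search.Cells.ConfigurationsTen

/-- Blocks of 25 consecutive entries of `reps10`. -/
def block10 (i : ℕ) : List (List ℕ) := (reps10.drop (25 * i)).take 25

set_option maxRecDepth 100000 in
/-- The 31 blocks reassemble `reps10`. -/
theorem reps10_eq_blocks : reps10 = (List.range 31).flatMap block10 := by decide +kernel

/-- From the blocks to the whole list. -/
theorem all_reps10_of_blocks {p : List ℕ → Bool} (h : ∀ i < 31, (block10 i).all p = true) : reps10.all p = true := by
  rw [reps10_eq_blocks, List.all_eq_true]
  intro σ hσ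
  rw [List.mem_flatMap] at hσ
  obtain ⟨i, hi, hσi⟩ := hσ
  rw [List.mem_range] at hi
  have := h i hi
  rw [List.all_eq_true] at this
  exact this σ hσi

-- 25 fast convergence tests per block, by kernel evaluation
set_option maxHeartbeats 4000000 in
/-- Block `0` (entries `0–24`) passes the fast test. -/
theorem fastConv_block0 : (block10 0).all (fastConv 10) = true := by decide +kernel

set_option maxHeartbeats 4000000 in
/-- Block `1` (entries `25–49`) passes the fast test. -/
theorem fastConv_block1 : (block10 1).all (fastConv 10) = true := by decide +kernel

set_option maxHeartbeats 4000000 in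
/-- Block `2` (entries `50–74`) passes the fast test. -/
theorem fastConv_block2 : (block10 2).all (fastConv 10) = true := by decide +kernel

set_option maxHeartbeats 4000000 in
/-- Block `3` (entries `75–99`) passes the fast test. -/
theorem fastConv_block3 : (block10 3).all (fastConv 10) = true := by decide +kernel

set_option maxHeartbeats 4000000 in
/-- Block `4` (entries `100–124`) passes the fast test. -/
theorem fastConv_block4 : (block10 4).all (fastConv 10) = true := by decide +kernel

set_option maxHeartbeats 4000000 in
/-- Block `5` (entries `125–149`) passes the fast test. -/
theorem fastConv_block5 : (block10 5).all (fastConv 10) = true := by decide +kernel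

set_option maxHeartbeats 4000000 in
/-- Block `6` (entries `150–174`) passes the fast test. -/
theorem fastConv_block6 : (block10 6).all (fastConv 10) = true := by decide +kernel

set_option maxHeartbeats 4000000 in
/-- Block `7` (entries `175–199`) passes the fast test. -/
theorem fastConv_block7 : (block10 7).all (fastConv 10) = true := by decide +kernel

set_option maxHeartbeats 4000000 in
/-- Block `8` (entries `200–224`) passes the fast test. -/
theorem fastConv_block8 : (block10 8).all (fastConv 10) = true := by decide +kernel

set_option maxHeartbeats 4000000 in
/-- Block `9` (entries `225–249`) passes the fast test. -/
theorem fastConv_block9 : (block10 9).all (fastConv 10) = true := by decide +kernel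

set_option maxHeartbeats 4000000 in
/-- Block `10` (entries `250–274`) passes the fast test. -/
theorem fastConv_block10 : (block10 10).all (fastConv 10) = true := by decide +kernel

set_option maxHeartbeats 4000000 in
/-- Block `11` (entries `275–299`) passes the fast test. -/
theorem fastConv_block11 : (block10 11).all (fastConv 10) = true := by decide +kernel

set_option maxHeartbeats 4000000 in
/-- Block `12` (entries `300–324`) passes the fast test. -/
theorem fastConv_block12 : (block10 12).all (fastConv 10) = true := by decide +kernel

set_option maxHeartbeats 4000000 in
/-- Block `13` (entries `325–349`) passes the fast test. -/
theorem fastConv_block13 : (block10 13).all (fastConv 10) = true := by decide +kernel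

set_option maxHeartbeats 4000000 in
/-- Block `14` (entries `350–374`) passes the fast test. -/
theorem fastConv_block14 : (block10 14).all (fastConv 10) = true := by decide +kernel

set_option maxHeartbeats 4000000 in
/-- Block `15` (entries `375–399`) passes the fast test. -/
theorem fastConv_block15 : (block10 15).all (fastConv 10) = true := by decide +kernel

set_option maxHeartbeats 4000000 in
/-- Block `16` (entries `400–424`) passes the fast test. -/
theorem fastConv_block16 : (block10 16).all (fastConv 10) = true := by decide +kernel

set_option maxHeartbeats 4000000 in
/-- Block `17` (entries `425–449`) passes the fast test. -/
theorem fastConv_block17 : (block10 17).all (fastConv 10) = true := by decide +kernel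

set_option maxHeartbeats 4000000 in
/-- Block `18` (entries `450–474`) passes the fast test. -/
theorem fastConv_block18 : (block10 18).all (fastConv 10) = true := by decide +kernel

set_option maxHeartbeats 4000000 in
/-- Block `19` (entries `475–499`) passes the fast test. -/
theorem fastConv_block19 : (block10 19).all (fastConv 10) = true := by decide +kernel

set_option maxHeartbeats 4000000 in
/-- Block `20` (entries `500–524`) passes the fast test. -/
theorem fastConv_block20 : (block10 20).all (fastConv 10) = true := by decide +kernel

set_option maxHeartbeats 4000000 in
/-- Block `21` (entries `525–549`) passes the fast test. -/
theorem fastConv_block21 : (block10 21).all (fastConv 10) = true := by decide +kernel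

set_option maxHeartbeats 4000000 in
/-- Block `22` (entries `550–574`) passes the fast test. -/
theorem fastConv_block22 : (block10 22).all (fastConv 10) = true := by decide +kernel

set_option maxHeartbeats 4000000 in
/-- Block `23` (entries `575–599`) passes the fast test. -/
theorem fastConv_block23 : (block10 23).all (fastConv 10) = true := by decide +kernel

set_option maxHeartbeats 4000000 in
/-- Block `24` (entries `600–624`) passes the fast test. -/
theorem fastConv_block24 : (block10 24).all (fastConv 10) = true := by decide +kernel

set_option maxHeartbeats 4000000 in
/-- Block `25` (entries `625–649`) passes the fast test. -/
theorem fastConv_block25 : (block10 25).all (fastConv 10) = true := by decide +kernel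

set_option maxHeartbeats 4000000 in
/-- Block `26` (entries `650–674`) passes the fast test. -/
theorem fastConv_block26 : (block10 26).all (fastConv 10) = true := by decide +kernel

set_option maxHeartbeats 4000000 in
/-- Block `27` (entries `675–699`) passes the fast test. -/
theorem fastConv_block27 : (block10 27).all (fastConv 10) = true := by decide +kernel

set_option maxHeartbeats 4000000 in
/-- Block `28` (entries `700–724`) passes the fast test. -/
theorem fastConv_block28 : (block10 28).all (fastConv 10) = true := by decide +kernel

set_option maxHeartbeats 4000000 in
/-- Block `29` (entries `725–749`) passes the fast test. -/
theorem fastConv_block29 : (block10 29).all (fastConv 10) = true := by decide +kernel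

set_option maxHeartbeats 4000000 in
/-- Block `30` (entries `750–770`) passes the fast test. -/
theorem fastConv_block30 : (block10 30).all (fastConv 10) = true := by decide +kernel

/-- All 771 listed plans pass the fast test. -/
theorem fastConv_reps10 : reps10.all (fastConv 10) = true := by
  apply all_reps10_of_blocks
  intro i hi
  interval_cases i
  exacts [fastConv_block0, fastConv_block1, fastConv_block2, fastConv_block3, fastConv_block4, fastConv_block5, fastConv_block6, fastConv_block7, fastConv_block8, fastConv_block9, fastConv_block10, fastConv_block11, fastConv_block12, fastConv_block13, fastConv_block14, fastConv_block15, fastConv_block16, fastConv_block17, fastConv_block18, fastConv_block19, fastConv_block20, fastConv_block21, fastConv_block22, fastConv_block23, fastConv_block24, fastConv_block25, fastConv_block26, fastConv_block27, fastConv_block28, fastConv_block29, fastConv_block30]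

/-- **All 771 listed `N = 10` plans are convergent** (kernel-certified via the fast test). [Brown2016, §1.5, App. 2 §10.1] -/
theorem isConvergent_reps10 : ∀ σ ∈ reps10, IsConvergent 10 σ := by
  intro σ hσ
  have h := fastConv_reps10
  rw [List.all_eq_true] at h
  exact isConvergent_of_fastConv' (h σ hσ)

/-- `𝒞₁₀ ≥ 771` with all three ingredients machine-checked: 771 plans, each convergent, pairwise inequivalent.
[Brown2016, App. 2 §10.1 (`𝒞₁₀ = 771`)] -/
theorem card_configurations_ten_ge :
    reps10.length = 771 ∧ (∀ σ ∈ reps10, IsConvergent 10 σ) ∧ (reps10.Pairwise fun σ τ => ¬ Equivalent 10 σ τ) :=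
  ⟨reps10_length, isConvergent_reps10, pairwise_not_equivalent_reps10⟩

end Summit.KontsevichZagierPeriods.Zeta5Search.Families.Configurations
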